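import Mathlib

/-!
# Crux `SkeletonJ1R` (stmt-NavierStokesRegularity-23610) · line `streamline_kantorovich_R` · stubs L-core / K — AFFINE PINNING BY STIFFNESS:
# a `C²` curve differs from its affine interpolant on `[a, b]` by at most `(M/2)(t − a)(b − t) ≤ M(b − a)²/8`, `M = sup ‖y″‖`

Lead `ns-fsr-lead-23610` g0, 2026-08-29.  Generic calculus (Mathlib only).  Use in the line: on the switched ball the linearised switched
defect is `β_j J Y″ +` (terms smaller by `Rb²`), so `‖Y″‖ ≤ (‖D‖ + …)/β_j` and the normal variation is its affine interpolant (a near-kernel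
direction: translation + tilt of the datum line, L-notes §5) up to `ℓ²/(2β_j)·(…) = 4πRb²/γ_j·(…)` — the "sup-gain `8πRb²/γ_j` on the complement of
the affine modes" of the line card (stub L-core `CorePinningL`, and the Lipschitz bookkeeping of stub K).  MODEL rung; nothing here bears on
Navier–Stokes regularity.

* `le_parabola_of_neg_le_deriv_two` / `abs_le_parabola_of_abs_deriv_two_le` — scalar: `g(a) = g(b) = 0`, `−M ≤ g″` (resp. `|g″| ≤ M`) on `[a, b]` ⇒
  `g t ≤ (M/2)(t − a)(b − t)` (resp. `|g t| ≤ …`) (convexity of `g + (M/2)(s − a)(s − b)`);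
* `norm_sub_affine_le_of_norm_iteratedDeriv_two_le` — vector-valued (real inner-product space): `‖y t − (y a + ((t−a)/(b−a))•(y b − y a))‖ ≤
  (M/2)(t − a)(b − t)` for `‖y″‖ ≤ M` on `[a, b]` (scalarise along the unit vector of the deviation).
-/

set_option linter.dupNamespace false -- `NavierStokesRegularity.NavierStokesRegularity` path/namespace repetition is the tree convention
set_option linter.style.longLine false -- statement lines follow the registered skeleton's layout

namespace Summit.NavierStokesRegularity.NavierStokesRegularity.Theorems.SkeletonJ1RFrame

open Set Function Filter Real Topology
open scoped InnerProductSpace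

/-! ## §1 Scalar parabola bounds -/

/-- `g(a) = g(b) = 0`, `g` twice differentiable with `−M ≤ g″` on `[a, b]` ⇒ `g t ≤ (M/2)(t − a)(b − t)` on `[a, b]`. [folklore] -/
theorem le_parabola_of_neg_le_deriv_two {g : ℝ → ℝ} (hg : Differentiable ℝ g) (hg' : Differentiable ℝ (deriv g)) {a b M : ℝ} (hab : a ≤ b)
    (hga : g a = 0) (hgb : g b = 0) (hM : ∀ s ∈ Icc a b, -M ≤ deriv (deriv g) s) :
    ∀ t ∈ Icc a b, g t ≤ M / 2 * (t - a) * (b - t) := by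
  -- q = g + (M/2)(s - a)(s - b) is convex on [a, b] and vanishes at the ends
  set q : ℝ → ℝ := fun s => g s + M / 2 * (s - a) * (s - b) with hq
  have hp : ∀ s, HasDerivAt (fun s : ℝ => M / 2 * (s - a) * (s - b)) (M / 2 * (2 * s - a - b)) s := fun s => by
    have h := (((hasDerivAt_id' s).sub_const a).const_mul (M / 2)).mul ((hasDerivAt_id' s).sub_const b)
    exact h.congr_deriv (by ring)
  have hq1 : ∀ s, HasDerivAt q (deriv g s + M / 2 * (2 * s - a - b)) s := fun s => (hg s).hasDerivAt.add (hp s)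
  have hqd : deriv q = fun s => deriv g s + M / 2 * (2 * s - a - b) := funext fun s => (hq1 s).deriv
  have hq2 : ∀ s, HasDerivAt (deriv q) (deriv (deriv g) s + M) s := fun s => by
    rw [hqd]
    have h := (hg' s).hasDerivAt.add (((((hasDerivAt_id' s).const_mul 2).sub_const a).sub_const b).const_mul (M / 2))
    exact h.congr_deriv (by ring)
  have hconv : ConvexOn ℝ (Icc a b) q := by
    refine convexOn_of_deriv2_nonneg (convex_Icc a b) (fun s _ => (hq1 s).continuousAt.continuousWithinAt)
      (fun s _ => (hq1 s).differentiableAt.differentiableWithinAt) (fun s _ => (hq2 s).differentiableAt.differentiableWithinAt) ?_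
    intro s hs
    rw [interior_Icc] at hs
    rw [Function.iterate_succ_apply', Function.iterate_one, (hq2 s).deriv]
    linarith [hM s ⟨hs.1.le, hs.2.le⟩]
  intro t ht
  have hseg : t ∈ segment ℝ a b := by rw [segment_eq_Icc hab]; exact ht
  have h := hconv.le_max_of_mem_segment (left_mem_Icc.2 hab) (right_mem_Icc.2 hab) hseg
  have hqa : q a = 0 := by simp [hq, hga]
  have hqb : q b = 0 := by simp [hq, hgb]
  rw [hqa, hqb, max_self] at h
  have : q t = g t + M / 2 * (t - a) * (t - b) := rfl
  nlinarith [h, this]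

/-- `g(a) = g(b) = 0`, `|g″| ≤ M` on `[a, b]` ⇒ `|g t| ≤ (M/2)(t − a)(b − t)` on `[a, b]`. [folklore] -/
theorem abs_le_parabola_of_abs_deriv_two_le {g : ℝ → ℝ} (hg : Differentiable ℝ g) (hg' : Differentiable ℝ (deriv g)) {a b M : ℝ}
    (hab : a ≤ b) (hga : g a = 0) (hgb : g b = 0) (hM : ∀ s ∈ Icc a b, |deriv (deriv g) s| ≤ M) :
    ∀ t ∈ Icc a b, |g t| ≤ M / 2 * (t - a) * (b - t) := by
  intro t ht
  have h1 := le_parabola_of_neg_le_deriv_two hg hg' hab hga hgb (fun s hs => (abs_le.1 (hM s hs)).1) t ht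
  have hng : Differentiable ℝ (fun s => -g s) := hg.neg
  have hdn : deriv (fun s => -g s) = fun s => -deriv g s := funext fun s => ((hg s).hasDerivAt.neg).deriv
  have hng' : Differentiable ℝ (deriv fun s => -g s) := by rw [hdn]; exact hg'.neg
  have h2 := le_parabola_of_neg_le_deriv_two (M := M) hng hng' hab (by simp [hga]) (by simp [hgb])
    (fun s hs => by
      have e : deriv (fun s => -deriv g s) s = -deriv (deriv g) s := ((hg' s).hasDerivAt.neg).deriv
      rw [hdn, e]
      linarith [(abs_le.1 (hM s hs)).2]) t ht
  exact abs_le.2 ⟨by linarith, h1⟩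

/-! ## §2 Vector-valued: deviation from the affine interpolant -/

variable {E : Type*} [NormedAddCommGroup E] [InnerProductSpace ℝ E]

/-- **Affine pinning by stiffness.**  For a `C²` curve `y` in a real inner-product space with `‖y″‖ ≤ M` on `[a, b]` (`a < b`):
`‖y t − (y a + ((t − a)/(b − a))•(y b − y a))‖ ≤ (M/2)(t − a)(b − t)` on `[a, b]` (hence `≤ M(b − a)²/8`). [folklore] -/
theorem norm_sub_affine_le_of_norm_iteratedDeriv_two_le {y : ℝ → E} (hy : ContDiff ℝ 2 y) {a b M : ℝ} (hab : a < b)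
    (hM : ∀ s ∈ Icc a b, ‖iteratedDeriv 2 y s‖ ≤ M) :
    ∀ t ∈ Icc a b, ‖y t - (y a + ((t - a) / (b - a)) • (y b - y a))‖ ≤ M / 2 * (t - a) * (b - t) := by
  intro t ht
  -- derivatives of y
  have hyd : Differentiable ℝ y := hy.differentiable (by norm_num)
  have hy'C : ContDiff ℝ 1 (deriv y) := (contDiff_succ_iff_deriv.1 (show ContDiff ℝ (1 + 1) y from hy)).2.2
  have hy'd : Differentiable ℝ (deriv y) := hy'C.differentiable (by norm_num)
  have hy2 : iteratedDeriv 2 y = deriv (deriv y) := by rw [iteratedDeriv_succ, iteratedDeriv_one]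
  -- the deviation φ and its scalarisation
  set φ : ℝ → E := fun s => y s - (y a + ((s - a) / (b - a)) • (y b - y a)) with hφ
  set v : E := φ t with hv
  by_cases hv0 : v = 0
  · have h0 : y t - (y a + ((t - a) / (b - a)) • (y b - y a)) = 0 := by simpa [hv, hφ] using hv0
    rw [h0, norm_zero]
    have h1 : 0 ≤ M := (norm_nonneg _).trans (hM a ⟨le_rfl, hab.le⟩)
    have h2 : 0 ≤ t - a := by linarith [ht.1]
    have h3 : 0 ≤ b - t := by linarith [ht.2]
    positivity
  set u : E := ‖v‖⁻¹ • v with hu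
  have hvu : ⟪v, u⟫_ℝ = ‖v‖ := by
    rw [hu, real_inner_smul_right, real_inner_self_eq_norm_sq]
    field_simp [norm_ne_zero_iff.2 hv0]
  have hu1 : ‖u‖ = 1 := by
    rw [hu, norm_smul, norm_inv, norm_norm, inv_mul_cancel₀ (norm_ne_zero_iff.2 hv0)]
  set g : ℝ → ℝ := fun s => ⟪φ s, u⟫_ℝ with hg
  have hab0 : b - a ≠ 0 := by linarith
  -- derivatives of φ and g
  have hφ1 : ∀ s, HasDerivAt φ (deriv y s - (1 / (b - a)) • (y b - y a)) s := fun s => by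
    have hl : HasDerivAt (fun s : ℝ => (s - a) / (b - a)) (1 / (b - a)) s := by
      have := ((hasDerivAt_id s).sub_const a).div_const (b - a)
      simpa using this
    exact (hyd s).hasDerivAt.sub ((hl.smul_const (y b - y a)).const_add (y a))
  have hg1 : ∀ s, HasDerivAt g ⟪deriv y s - (1 / (b - a)) • (y b - y a), u⟫_ℝ s := fun s => by
    have h := (hφ1 s).inner ℝ (hasDerivAt_const s u)
    simpa using h
  have hgd : deriv g = fun s => ⟪deriv y s - (1 / (b - a)) • (y b - y a), u⟫_ℝ := funext fun s => (hg1 s).deriv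
  have hg2 : ∀ s, HasDerivAt (deriv g) ⟪iteratedDeriv 2 y s, u⟫_ℝ s := fun s => by
    rw [hgd, hy2]
    have h := (((hy'd s).hasDerivAt).sub_const ((1 / (b - a)) • (y b - y a))).inner ℝ (hasDerivAt_const s u)
    simpa using h
  have hgdiff : Differentiable ℝ g := fun s => (hg1 s).differentiableAt
  have hg'diff : Differentiable ℝ (deriv g) := fun s => (hg2 s).differentiableAt
  have hga : g a = 0 := by simp [hg, hφ]
  have hgb : g b = 0 := by
    simp only [hg, hφ, div_self hab0, one_smul]
    rw [show y b - (y a + (y b - y a)) = 0 by abel, inner_zero_left]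
  have hgM : ∀ s ∈ Icc a b, |deriv (deriv g) s| ≤ M := fun s hs => by
    rw [(hg2 s).deriv]
    calc |⟪iteratedDeriv 2 y s, u⟫_ℝ| ≤ ‖iteratedDeriv 2 y s‖ * ‖u‖ := abs_real_inner_le_norm _ _
      _ ≤ M := by rw [hu1, mul_one]; exact hM s hs
  have h := abs_le_parabola_of_abs_deriv_two_le hgdiff hg'diff hab.le hga hgb hgM t ht
  have hgt : g t = ‖v‖ := by simp only [hg]; rw [← hv]; exact hvu
  rw [hgt, abs_of_nonneg (norm_nonneg _)] at h
  simpa [hv, hφ] using h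

end Summit.NavierStokesRegularity.NavierStokesRegularity.Theorems.SkeletonJ1RFrame
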